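import Summits.QuantumFields.BalabanUV.Beta.CompositeOneShotJets
import Summits.QuantumFields.BalabanUV.Beta.CompositeMixedTableGradedBounds
import Summits.QuantumFields.BalabanUV.Beta.CompositeOneShotJetData
import Summits.QuantumFields.BalabanUV.Beta.FP.TowerDoorRecordDefs

/-!
# `BalabanUV.Beta.CompositeOneShotJetsGraded` — row D1 ∕ (C1) OWNER «beta-an2», PART 92, v11 (T1), DEFINITIONS: **THE GRADED COMPOSITE TABLE RECORD** — F6d-1b's
# `tabsComp r L m cM` with ITS `mixFF` SLOT REPLACED BY (F0)'s GRADED TABLE `compMixG r L m` (every other table and letter unchanged): `tabsCompG r L m cM : SymTables d (L^m)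
# := tabsOf (L^m) (compV …) (compH …) cM (compB …) (compMixG r L m) ⟨letters⟩`, its `hmix` by PART 91 `compMixG_hmix`, its `hmixt` by 79a `compMixG_translate`; and the record-level
# abbreviation **`tabsRecG Lc Pn n := tabsCompG (n+2) … (Pn.cM (n+2))`** (PART 69's `tabsRec` one token over) — so that v11's `hM₂′` summand `M2Of 3 L (compMixG (ctrOff 4 Lc) Lc (n+2)) …`
# IS `M2Of 3 L (tabsRecG Lc Pn n).mixFF …` BY `rfl` (`tabsRecG_mixFF`), and the door record `doorRecG Lc Q (tabsRecG Lc Pn)` (PART 87) reads the END's ONE mixed table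
# (FINDING AN2-82-2, journal [AN2-G82-RCPT-4]); the `H ∕ V ∕ vh₂S ∕ M` slots are `tabsComp`'s (`tabsRecG_H : (tabsRecG …).H = (tabsRec …).H` etc., composed from the per-slot `rfl` letters — never by unifying the two records) so PART 74's `Ĉ_β` side is untouched
# (β-function cell `pub-balaban`, BINDER-OWNERS row D1)

[our object — bookkeeping] two definitions + [folklore] `rfl` field letters; nothing cited, 0 sorry.  Nothing of Bałaban's asserted, valued or discharged; 0 estimates; 0∕4 row-D1 binders;
v10's record (`tabsComp ∕ tabsRec`) untouched and still the END of record's; NOT (C1), NOT D1, NEVER «G-an2-4 closed», NOT BetaPertH, NOT continuum, NOT Clay.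

HONEST DEPENDENCY (page 1, mandatory): continuum YM on T⁴ ⇐ BetaPertH ∧ nine spine estimates (0/9 proved); BetaPertH ⇐ (D1) ∧
(D4) ∧ CAP+tail; G-an2-4 gates asym, D1 and NE2/3/4.  Row D1 ∕ (C1) OWNER «beta-an2», b2b-balaban-beta-an2 gen 82, 2026-08-29.  No existing file touched.
-/

noncomputable section

namespace Summit.QuantumFields.BalabanUV.Beta.CompositeOneShotJetsGraded

open Literature.MathematicalPhysics.QuantumFieldTheory
open Literature.MathematicalPhysics.QuantumFieldTheory.Balaban1983to89
open Literature.MathematicalPhysics.QuantumFieldTheory.Balaban1983to89.Beta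
open AffineAveraging (Site box toSite)
open AveragingContoursRooted (ctr ctrOff ctrOff_mem_box)
open Summit.QuantumFields.BalabanUV.Beta.AxialDressingRooted (one_le_of_neZero)
open Summit.QuantumFields.BalabanUV.Beta.SymmetrisedStepJets (SymTables)
open Summit.QuantumFields.BalabanUV.Beta.SymTablesOf (tabsOf)
open Summit.QuantumFields.BalabanUV.Beta.CompositeOneShotJets (compV compH compB compMix tabsComp tabsComp_H tabsComp_V tabsComp_vh₂S compV_hV compH_hH compB_hB compV_hVt compH_hHt compB_hBt)
open Summit.QuantumFields.BalabanUV.Beta.CompositeOneShotJetData (Roots Roots.ctr Pins)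
open Summit.QuantumFields.BalabanUV.Beta.CompositeMixedTableGraded (compMixG)
open Summit.QuantumFields.BalabanUV.Beta.CompositeMixedTableGradedCov (compMixG_translate)
open Summit.QuantumFields.BalabanUV.Beta.CompositeMixedTableGradedBounds (compMixG_hmix)
open Summit.QuantumFields.BalabanUV.Beta.FP.TowerDoorRecordDefs (tabsRec)

variable {d : ℕ}

/-! ## §1 The graded composite table record at depth `m` -/

section Tables

variable (r : Fin (d + 1) → ℕ) (L m : ℕ)
variable {r L} (hL : 1 ≤ L) (hr : r ∈ box (d + 1) L)

/-- [our object — bookkeeping] **THE GRADED COMPOSITE TABLE RECORD AT DEPTH `m`** — `tabsComp r L m cM` with `mixFF := compMixG r L m` (the other four tables and their letters as in F6d-1b;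
`hmix` by PART 91 `compMixG_hmix`, `hmixt` by 79a `compMixG_translate`). -/
def tabsCompG (cM : ℕ → ℝ) : SymTables d (L ^ m) :=
  tabsOf (L ^ m) (compV r L m) (compH r L m) cM (compB r L m) (compMixG r L m)
    (compV_hV m hL hr) (compH_hH m hL hr) (compB_hB m hL hr) (compMixG_hmix hL hr m)
    (compV_hVt m hL) (compH_hHt m) (compB_hBt m hL) (fun κ u μ w t => compMixG_translate m κ u μ w t)

/-- [folklore] (`rfl`) the graded record's mixed slot IS (F0)'s graded table. -/
theorem tabsCompG_mixFF (cM : ℕ → ℝ) : (tabsCompG m hL hr cM).mixFF = compMixG r L m := rfl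

/-- [folklore] (`rfl`) the Hessian slot. -/
theorem tabsCompG_H (cM : ℕ → ℝ) : (tabsCompG m hL hr cM).H = compH r L m := rfl

/-- [folklore] (`rfl`) the border slot. -/
theorem tabsCompG_V (cM : ℕ → ℝ) : (tabsCompG m hL hr cM).V = compV r L m := rfl

/-- [folklore] (`rfl`) the second-order border slot. -/
theorem tabsCompG_vh₂S (cM : ℕ → ℝ) : (tabsCompG m hL hr cM).vh₂S = compB r L m := rfl

/-- [folklore] the Hessian slot is `tabsComp`'s (by the two `rfl` letters, composed — NOT by unifying the two records, which would compare `compMixG` with `compMix`). -/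
theorem tabsCompG_H_eq_tabsComp_H (cM : ℕ → ℝ) : (tabsCompG m hL hr cM).H = (tabsComp m hL hr cM).H :=
  (tabsCompG_H m hL hr cM).trans (tabsComp_H m hL hr cM).symm

/-- [folklore] the border slot is `tabsComp`'s. -/
theorem tabsCompG_V_eq_tabsComp_V (cM : ℕ → ℝ) : (tabsCompG m hL hr cM).V = (tabsComp m hL hr cM).V :=
  (tabsCompG_V m hL hr cM).trans (tabsComp_V m hL hr cM).symm

/-- [folklore] the second-order border slot is `tabsComp`'s. -/
theorem tabsCompG_vh₂S_eq_tabsComp_vh₂S (cM : ℕ → ℝ) : (tabsCompG m hL hr cM).vh₂S = (tabsComp m hL hr cM).vh₂S :=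
  (tabsCompG_vh₂S m hL hr cM).trans (tabsComp_vh₂S m hL hr cM).symm

end Tables

/-! ## §2 The record-level abbreviation at door index `n+1` (`d = 3`, root `Roots.ctr Lc`, v10's pins) -/

section Record

variable (Lc : ℕ) [NeZero Lc]

/-- [our object — bookkeeping] **THE GRADED TABLE RECORD AT THE DOOR's DEPTH** — PART 69 `tabsRec Lc Pn n := tabsComp (n+2) … (Pn.cM (n+2))` with `tabsComp ↦ tabsCompG`:
its `mixFF` is `compMixG (ctrOff 4 Lc) Lc (n+2)`, v11's `hM₂′` token. -/
def tabsRecG (Pn : Pins) (n : ℕ) : SymTables 3 (Lc ^ (n + 1 + 1)) :=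
  tabsCompG (n + 1 + 1) (Nat.one_le_iff_ne_zero.mpr (NeZero.ne Lc)) (Roots.ctr Lc).hr (Pn.cM (n + 1 + 1))

/-- [folklore] (`rfl`) **`(tabsRecG Lc Pn n).mixFF = compMixG (ctrOff (3+1) Lc) Lc (n+2)`** — v11's `hM₂′` reads `M2Of 3 _ (tabsRecG …).mixFF 0 …` definitionally. -/
theorem tabsRecG_mixFF (Pn : Pins) (n : ℕ) : (tabsRecG Lc Pn n).mixFF = compMixG (ctrOff (3 + 1) Lc) Lc (n + 1 + 1) := rfl

/-- [folklore] the Hessian slot of the graded record is v10's (`(tabsRec Lc Pn n).H`) — PART 74's `Ĉ_β` side is unchanged (composed from the two `rfl` letters). -/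
theorem tabsRecG_H (Pn : Pins) (n : ℕ) : (tabsRecG Lc Pn n).H = (tabsRec Lc Pn n).H :=
  tabsCompG_H_eq_tabsComp_H (n + 1 + 1) (Nat.one_le_iff_ne_zero.mpr (NeZero.ne Lc)) (Roots.ctr Lc).hr (Pn.cM (n + 1 + 1))

/-- [folklore] the border slot of the graded record is v10's. -/
theorem tabsRecG_V (Pn : Pins) (n : ℕ) : (tabsRecG Lc Pn n).V = (tabsRec Lc Pn n).V :=
  tabsCompG_V_eq_tabsComp_V (n + 1 + 1) (Nat.one_le_iff_ne_zero.mpr (NeZero.ne Lc)) (Roots.ctr Lc).hr (Pn.cM (n + 1 + 1))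

/-- [folklore] the second-order border slot of the graded record is v10's. -/
theorem tabsRecG_vh₂S (Pn : Pins) (n : ℕ) : (tabsRecG Lc Pn n).vh₂S = (tabsRec Lc Pn n).vh₂S :=
  tabsCompG_vh₂S_eq_tabsComp_vh₂S (n + 1 + 1) (Nat.one_le_iff_ne_zero.mpr (NeZero.ne Lc)) (Roots.ctr Lc).hr (Pn.cM (n + 1 + 1))

end Record

end Summit.QuantumFields.BalabanUV.Beta.CompositeOneShotJetsGraded

end
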